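import Literature.NumberTheory.Automorphic.GLnStandardLeviUnimodular
import Literature.NumberTheory.Automorphic.GLnMaximalParabolicLocalModulus
import Literature.NumberTheory.Automorphic.KNAQuotientIntegration
import Literature.NumberTheory.Automorphic.ParabolicInduction
import Literature.MeasureTheory.Group.InvariantQuotientConjugacySum
import HarnessLib

/-!
# Integration over `GL_n(F) ⧸ M_c(F)` in Iwasawa coordinates: every invariant measure on
# `G ⧸ M_c` is `C · ((k, u) ↦ k u M_c)_* (dk ⊗ du)`, and `∫_{G ⧸ M_c} f(y γ y⁻¹) = C ∫_{K × U_c} f(k u γ u⁻¹ k⁻¹)`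

Topic `NumberTheory/Automorphic`; namespace `Literature.NumberTheory.Automorphic`. KERNEL
mathematics only: theorems, no definition, no named fact, no instance, no `sorry`. Road «D-S1»
(parabolic descent of orbital integrals, Rogawski 1990 Lemma 4.13.1, proof p. 70: «the quotient
measure on `G ⧸ M` … `G = KP`, `P = MU`») for `G = GL_n(F)`, `F` a non-archimedean local field,
`K = GL_n(𝒪)` (`glInt`), `P_c ⊇ B` the standard parabolic of a MONOTONE block labelling
`c : Fin n → α`, `M_c` its standard Levi subgroup and `U_c` its unipotent radical: the tree's abstract
`K N A` integration formula (`KNAQuotientIntegration.exists_measure_quotient_eq_smul_map`, Gelbart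
1975 Thm. 9.22 (iii)) with ALL its hypotheses discharged —
`K` compact (`isCompact_glInt`), `A = M_c` and `B = P_c` closed (`isClosed_standardLeviGL`,
`isClosed_standardParabolicGL`), `M_c` normalises `U_c` (`conj_mem_unipotentRadicalGL_of_mem_standardLeviGL`),
`M_c × U_c ≃ₜ P_c` (`exists_homeomorph_levi_prod_unipotent_coe_eq`), `G = K P_c`
(`exists_glInt_mul_mem_standardParabolicGL`), `G` and `M_c` unimodular
(`GLn.isInvInvariant_of_isHaarMeasure_local`, `isInvInvariant_haar_standardLeviGL`).

* §1 (any topological group) `integral_descConj_eq_smul_integral_prod` — the Bochner form of the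
  orbital integrand `descConj γ A _ f : G ⧸ A → E` (`y A ↦ f(y γ y⁻¹)`, the tree's orbital-integral
  currency) against `μ = C • ((k, u) ↦ k u A)_* (κ ⊗ μ_N)`:
  **`∫_{G ⧸ A} f(y γ y⁻¹) dμ(y) = C ∫_{K × N} f((k u) γ (k u)⁻¹) d(κ ⊗ μ_N)`** (strongly measurable
  integrand; `…_of_continuous` for continuous `f`).
* §2 (`isClosed_unipotentRadicalGL_aux`, private: `U_c` is closed)
  `exists_quotientMeasure_levi_eq_smul_map` — for `A = M_c` (stated with a free subgroup `A` and
  `(hA : A = standardLeviGL F c)`, so that a consumer may take `A := C_G(z)` with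
  `centralizer_blockDiagonalGL_scalar_eq_standardLeviGL` and its separation hypothesis): **every
  non-zero `G`-invariant measure `μ` on `G ⧸ A`, finite on compact sets, is
  `μ = C • ((k, u) ↦ k u A)_* (κ ⊗ μ_U)`** for any Haar measures `κ` on `K`, `μ_U` on `U_c` (`μ_U`
  inversion invariant), with `C ≠ 0`; `exists_integral_descConj_levi_eq_smul` — hence
  `∫_{G ⧸ A} f(y γ y⁻¹) dμ = C ∫_{K × U_c} f((k u) γ (k u)⁻¹)` for every continuous `f` and every `γ`
  centralised by `A`, ONE constant `C` for all `(γ, f)`.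
* §3 `exists_boxHomeomorph_unipotentRadicalGL` — for a TWO-block labelling `c : n → Bool`, box
  coordinates `R^{I × J} ≃ₜ U_c(R)` (additive) on the unipotent radical as a subgroup of `GL_n(R)`;
  `isInvInvariant_haar_unipotentRadicalGL` — `U_c(F) ≅ F^{I × J}` is commutative, so every Haar
  measure on it is inversion invariant; `exists_quotientMeasure_levi_eq_smul_map_bool`, `exists_integral_descConj_levi_eq_smul_bool`
  — §2 for two blocks with that hypothesis discharged (the case `GL_3 ⊃ P_{(2,1)}` of Rogawski).

## References

* [Rogawski1990] J. D. Rogawski, *Automorphic Representations of Unitary Groups in Three Variables*,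
  Ann. of Math. Stud. 123 (1990), §4.13, proof of Lemma 4.13.1, p. 70.
* [Gelbart1975] S. Gelbart, *Automorphic forms on adele groups*, Ann. of Math. Stud. 83 (1975),
  Thm. 9.22 (iii), Remark 9.23 (`∫_{A \ G} = ∫_N ∫_K`).
* [BernsteinZelevinsky1977] I. N. Bernstein, A. V. Zelevinsky, *Induced representations of reductive
  `p`-adic groups I*, Ann. Sci. ÉNS 10 (1977), §2.1.
-/

noncomputable section

open scoped MatrixGroups NNReal ENNReal
open MeasureTheory Measure Matrix Topology

namespace Literature.NumberTheory.Automorphic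

open Literature.MeasureTheory.Group

/-! ### 1. The Bochner form of the orbital integrand in `K N` coordinates -/

section Generic

variable {G : Type*} [Group G] [TopologicalSpace G] [IsTopologicalGroup G] [SecondCountableTopology G]
  [MeasurableSpace G] [BorelSpace G] {K A N : Subgroup G}
  (κ : Measure K) (μN : Measure N)
  [MeasurableSpace (G ⧸ A)] [BorelSpace (G ⧸ A)] (μ : Measure (G ⧸ A))
  {E : Type*} [NormedAddCommGroup E] [NormedSpace ℝ E]

/-- **`∫_{G ⧸ A} f(y γ y⁻¹) dμ(y) = C ∫_{K × N} f((k u) γ (k u)⁻¹) d(κ ⊗ μ_N)`** once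
`μ = C • ((k, u) ↦ k u A)_* (κ ⊗ μ_N)` (`integral_quotient_eq_smul_integral_prod` applied to the
orbital integrand `descConj γ A _ f`, for a strongly measurable integrand; no integrability needed).
(Gelbart 1975, Remark 9.23: `∫_{A \ G} f(g⁻¹ γ g) dg = ∫_N ∫_K f(k⁻¹ n⁻¹ γ n k) dn dk`.)
[cite: Gelbart1975, Thm. 9.22 (iii) and Remark 9.23] -/
theorem integral_descConj_eq_smul_integral_prod {C : ℝ≥0}
    (hμC : μ = C • Measure.map
      (fun p : K × N => (QuotientGroup.mk ((p.1 : G) * (p.2 : G)) : G ⧸ A)) (κ.prod μN))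
    (γ : G) (hγ : ∀ a ∈ A, a * γ = γ * a) (f : G → E)
    (hf : StronglyMeasurable (descConj γ A hγ f)) :
    ∫ y, descConj γ A hγ f y ∂μ =
      C • ∫ p : K × N, f ((p.1 : G) * (p.2 : G) * γ * ((p.1 : G) * (p.2 : G))⁻¹) ∂(κ.prod μN) := by
  rw [integral_quotient_eq_smul_integral_prod κ μN μ hμC _ hf]
  rfl

/-- The same for a CONTINUOUS `f` (the orbital integrand is then continuous, `continuous_descConj`,
hence strongly measurable on the second countable space `G ⧸ A`). [cite: Gelbart1975, Thm. 9.22 (iii) and Remark 9.23] -/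
theorem integral_descConj_eq_smul_integral_prod_of_continuous {C : ℝ≥0}
    (hμC : μ = C • Measure.map
      (fun p : K × N => (QuotientGroup.mk ((p.1 : G) * (p.2 : G)) : G ⧸ A)) (κ.prod μN))
    (γ : G) (hγ : ∀ a ∈ A, a * γ = γ * a) (f : G → E) (hf : Continuous f) :
    ∫ y, descConj γ A hγ f y ∂μ =
      C • ∫ p : K × N, f ((p.1 : G) * (p.2 : G) * γ * ((p.1 : G) * (p.2 : G))⁻¹) ∂(κ.prod μN) := by
  borelize E
  exact integral_descConj_eq_smul_integral_prod κ μN μ hμC γ hγ f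
    (continuous_descConj γ A hγ hf).stronglyMeasurable

end Generic

/-! ### 2. `G = GL_n(F)`, `A = M_c`, `K = GL_n(𝒪)`, `N = U_c` -/

section Closed

variable {R : Type*} [CommRing R] [TopologicalSpace R] [T1Space R] {m : Type*} [Fintype m]
  [DecidableEq m] {α : Type*} [LinearOrder α] (c : m → α)

/-- `U_c` is closed in `GL_n(R)` for a `T₁` topological ring `R` (cut out by `g_{ij} = 0` for
`c j < c i` and `g_{ij} = δ_{ij}` for `c i = c j`, `mem_unipotentRadicalGL_iff`); a local copy, under
the weaker `T₁` hypothesis, of the tree's `isClosed_unipotentRadicalGL`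
(`UnipotentRadicalCompactOpenProofs`, not imported here). [cite: BernsteinZelevinsky1977, §2.1] -/
private theorem isClosed_unipotentRadicalGL_aux : IsClosed (unipotentRadicalGL R c : Set (GL m R)) := by
  have h : (unipotentRadicalGL R c : Set (GL m R)) =
      (⋂ i, ⋂ j, {g : GL m R | c j < c i → (g : Matrix m m R) i j = 0}) ∩
        ⋂ i, ⋂ j, {g : GL m R | c i = c j → (g : Matrix m m R) i j = if i = j then 1 else 0} := by
    ext g
    simp only [SetLike.mem_coe, mem_unipotentRadicalGL_iff, Set.mem_inter_iff, Set.mem_iInter,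
      Set.mem_setOf_eq]
    refine and_congr Iff.rfl ⟨fun h i j hij => ?_, fun h a => ?_⟩
    · have hij' := congrFun (congrFun (h (c i)) ⟨i, rfl⟩) ⟨j, hij.symm⟩
      rw [Matrix.toSquareBlock_def, Matrix.of_apply, Matrix.one_apply] at hij'
      rw [hij']
      by_cases hij2 : i = j
      · subst hij2; simp
      · rw [if_neg hij2, if_neg (fun h' => hij2 (congrArg Subtype.val h'))]
    · ext ⟨i, hi⟩ ⟨j, hj⟩
      rw [Matrix.toSquareBlock_def, Matrix.of_apply, Matrix.one_apply, h i j (hi.trans hj.symm)]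
      by_cases hij2 : i = j
      · subst hij2; simp
      · rw [if_neg hij2, if_neg (fun h' => hij2 (congrArg Subtype.val h'))]
  rw [h]
  refine IsClosed.inter (isClosed_iInter fun i => isClosed_iInter fun j => ?_)
    (isClosed_iInter fun i => isClosed_iInter fun j => ?_)
  · by_cases hij : c j < c i
    · have : {g : GL m R | c j < c i → (g : Matrix m m R) i j = 0} =
          (fun g : GL m R => (g : Matrix m m R) i j) ⁻¹' {0} := by
        ext g; simp [hij]
      rw [this]
      exact isClosed_singleton.preimage (Units.continuous_val.matrix_elem i j)
    · simp [hij]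
  · by_cases hij : c i = c j
    · have : {g : GL m R | c i = c j → (g : Matrix m m R) i j = if i = j then 1 else 0} =
          (fun g : GL m R => (g : Matrix m m R) i j) ⁻¹' {if i = j then (1 : R) else 0} := by
        ext g; simp only [hij, forall_const, Set.mem_setOf_eq, Set.mem_preimage,
          Set.mem_singleton_iff]
      rw [this]
      exact isClosed_singleton.preimage (Units.continuous_val.matrix_elem i j)
    · simp [hij]

end Closed

section GeneralLinear

open Literature.NumberTheory.GaloisRepresentations.IsNonarchimedeanLocalField

variable (F : Type*) [Field F] [ValuativeRel F] [TopologicalSpace F] [IsNonarchimedeanLocalField F]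
  {n : ℕ} {α : Type*} [LinearOrder α] [Fintype α] {c : Fin n → α}
  [MeasurableSpace (GL (Fin n) F)] [BorelSpace (GL (Fin n) F)]

omit [MeasurableSpace (GL (Fin n) F)] [BorelSpace (GL (Fin n) F)] in
/-- `GL_n(F)` is second countable (`F` is; `GL_n(F) ↪ M_n(F) × M_n(F)ᵐᵒᵖ`). [folklore] -/
private theorem secondCountableTopology_GL' : SecondCountableTopology (GL (Fin n) F) := by
  haveI : SecondCountableTopology F := secondCountableTopology_localField F
  haveI : SecondCountableTopology (Matrix (Fin n) (Fin n) F) :=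
    inferInstanceAs (SecondCountableTopology (Fin n → Fin n → F))
  haveI : SecondCountableTopology (Matrix (Fin n) (Fin n) F)ᵐᵒᵖ :=
    MulOpposite.opHomeomorph.symm.secondCountableTopology
  exact Units.isEmbedding_embedProduct.secondCountableTopology

omit [MeasurableSpace (GL (Fin n) F)] [BorelSpace (GL (Fin n) F)] in
/-- `GL_n(F)` is locally compact (`M_n(F) = F^{n × n}` is, and Mathlib's instance for the unit group
of a monoid with the embedding topology `GL_n ↪ M_n × M_nᵐᵒᵖ` onto a closed subset). [folklore] -/
private theorem locallyCompactSpace_GL : LocallyCompactSpace (GL (Fin n) F) := by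
  haveI : T2Space F := (isLocalField F).toT2Space
  haveI : LocallyCompactSpace F := (isLocalField F).toLocallyCompactSpace
  haveI : LocallyCompactSpace (Matrix (Fin n) (Fin n) F) :=
    inferInstanceAs (LocallyCompactSpace (Fin n → Fin n → F))
  infer_instance

/-- **Every invariant measure on `GL_n(F) ⧸ M_c(F)` in Iwasawa coordinates** (Rogawski 1990, proof
of Lemma 4.13.1 p. 70; Gelbart 1975, Thm. 9.22 (iii)): let `c : Fin n → α` be a monotone block
labelling (so `B ⊆ P_c`), `A = M_c` its standard Levi subgroup (any subgroup `A` with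
`A = standardLeviGL F c` — e.g. the centraliser of a regular block scalar,
`centralizer_blockDiagonalGL_scalar_eq_standardLeviGL`), `κ` a Haar measure on `K = GL_n(𝒪)` and
`μ_U` an inversion-invariant Haar measure on `U_c`. Then every non-zero `G`-invariant measure `μ` on
`G ⧸ A` finite on compact sets is **`μ = C • ((k, u) ↦ k u A)_* (κ ⊗ μ_U)` with `C ≠ 0`**. All
hypotheses of `exists_measure_quotient_eq_smul_map` are theorems of the tree for this configuration
(see the module docstring). [cite: Rogawski1990, §4.13, proof of Lemma 4.13.1, p. 70] -/
theorem exists_quotientMeasure_levi_eq_smul_map (hc : Monotone c)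
    {A : Subgroup (GL (Fin n) F)} (hA : A = standardLeviGL F c)
    [MeasurableSpace (GL (Fin n) F ⧸ A)] [BorelSpace (GL (Fin n) F ⧸ A)]
    (μ : Measure (GL (Fin n) F ⧸ A)) [SMulInvariantMeasure (GL (Fin n) F) (GL (Fin n) F ⧸ A) μ]
    [IsFiniteMeasureOnCompacts μ] (hμ : μ ≠ 0)
    (κ : Measure ↥(glInt n F)) [IsHaarMeasure κ]
    (μN : Measure ↥(unipotentRadicalGL F c)) [IsHaarMeasure μN] [μN.IsInvInvariant] :
    ∃ C : ℝ≥0, C ≠ 0 ∧ μ = C • Measure.map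
      (fun p : ↥(glInt n F) × ↥(unipotentRadicalGL F c) =>
        (QuotientGroup.mk ((p.1 : GL (Fin n) F) * (p.2 : GL (Fin n) F)) : GL (Fin n) F ⧸ A))
      (κ.prod μN) := by
  subst hA
  haveI : T2Space F := (isLocalField F).toT2Space
  haveI : IsTopologicalRing F := inferInstance
  haveI : SecondCountableTopology (GL (Fin n) F) := secondCountableTopology_GL' F
  haveI : LocallyCompactSpace (GL (Fin n) F) := locallyCompactSpace_GL F
  haveI : LocallyCompactSpace ↥(standardLeviGL F c) :=
    (isClosed_standardLeviGL (R := F) c).locallyCompactSpace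
  haveI : SecondCountableTopology ↥(standardLeviGL F c) :=
    TopologicalSpace.Subtype.secondCountableTopology _
  haveI : SecondCountableTopology ↥(glInt n F) := TopologicalSpace.Subtype.secondCountableTopology _
  haveI : SecondCountableTopology ↥(unipotentRadicalGL F c) :=
    TopologicalSpace.Subtype.secondCountableTopology _
  haveI : BorelSpace ↥(standardLeviGL F c) := Subtype.borelSpace _
  haveI : BorelSpace ↥(glInt n F) := Subtype.borelSpace _
  haveI : BorelSpace ↥(unipotentRadicalGL F c) := Subtype.borelSpace _
  haveI : CompactSpace ↥(glInt n F) := isCompact_iff_compactSpace.1 (isCompact_glInt n F)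
  haveI : LocallyCompactSpace ↥(unipotentRadicalGL F c) :=
    (isClosed_unipotentRadicalGL_aux (R := F) c).locallyCompactSpace
  haveI : IsFiniteMeasure κ := CompactSpace.isFiniteMeasure
  haveI : SFinite κ := inferInstance
  haveI : SFinite μN := inferInstance
  -- the two auxiliary Haar measures of the `K N A` formula: on `G` and on `A`, both inversion invariant
  set ν : Measure (GL (Fin n) F) := Measure.haar with hν
  haveI : ν.IsInvInvariant := GLn.isInvInvariant_of_isHaarMeasure_local n F ν
  set αM : Measure ↥(standardLeviGL F c) := Measure.haar with hαM
  haveI : αM.IsInvInvariant := isInvInvariant_haar_standardLeviGL F c αM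
  haveI : SFinite αM := inferInstance
  obtain ⟨e, he⟩ := exists_homeomorph_levi_prod_unipotent_coe_eq F c
  exact exists_measure_quotient_eq_smul_map (isCompact_glInt n F) (isClosed_standardLeviGL (R := F) c)
    (isClosed_standardParabolicGL F c) (standardLeviGL_le F c) (unipotentRadicalGL_le F c)
    (fun a ha u hu => conj_mem_unipotentRadicalGL_of_mem_standardLeviGL c ha hu) e
    (fun p => Subtype.ext (he p)) (exists_glInt_mul_mem_standardParabolicGL hc) ν κ αM μN μ hμ

/-- **The orbital integrand over `GL_n(F) ⧸ M_c(F)` in Iwasawa coordinates**: in the setting of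
`exists_quotientMeasure_levi_eq_smul_map` there is ONE constant `C ≠ 0` with
**`∫_{G ⧸ A} f(y γ y⁻¹) dμ(y) = C ∫_{K × U_c} f((k u) γ (k u)⁻¹) d(κ ⊗ μ_U)`** for every continuous
`f : GL_n(F) → E` and every `γ` centralised by `A = M_c` (e.g. a block scalar `z`, where this is the
orbital integral `Φ(z, f)` of Rogawski 1990, §4.9, at the `M`-central point `z`). No integrability
hypothesis. [cite: Rogawski1990, §4.13, proof of Lemma 4.13.1, p. 70] -/
theorem exists_integral_descConj_levi_eq_smul (hc : Monotone c)
    {A : Subgroup (GL (Fin n) F)} (hA : A = standardLeviGL F c)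
    [MeasurableSpace (GL (Fin n) F ⧸ A)] [BorelSpace (GL (Fin n) F ⧸ A)]
    (μ : Measure (GL (Fin n) F ⧸ A)) [SMulInvariantMeasure (GL (Fin n) F) (GL (Fin n) F ⧸ A) μ]
    [IsFiniteMeasureOnCompacts μ] (hμ : μ ≠ 0)
    (κ : Measure ↥(glInt n F)) [IsHaarMeasure κ]
    (μN : Measure ↥(unipotentRadicalGL F c)) [IsHaarMeasure μN] [μN.IsInvInvariant]
    {E : Type*} [NormedAddCommGroup E] [NormedSpace ℝ E] :
    ∃ C : ℝ≥0, C ≠ 0 ∧ ∀ (γ : GL (Fin n) F) (hγ : ∀ a ∈ A, a * γ = γ * a) (f : GL (Fin n) F → E),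
      Continuous f →
        ∫ y, descConj γ A hγ f y ∂μ =
          C • ∫ p : ↥(glInt n F) × ↥(unipotentRadicalGL F c),
            f ((p.1 : GL (Fin n) F) * (p.2 : GL (Fin n) F) * γ *
              ((p.1 : GL (Fin n) F) * (p.2 : GL (Fin n) F))⁻¹) ∂(κ.prod μN) := by
  haveI : SecondCountableTopology (GL (Fin n) F) := secondCountableTopology_GL' F
  haveI : SecondCountableTopology ↥(glInt n F) := TopologicalSpace.Subtype.secondCountableTopology _
  haveI : SecondCountableTopology ↥(unipotentRadicalGL F c) :=
    TopologicalSpace.Subtype.secondCountableTopology _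
  haveI : BorelSpace ↥(glInt n F) := Subtype.borelSpace _
  haveI : BorelSpace ↥(unipotentRadicalGL F c) := Subtype.borelSpace _
  obtain ⟨C, hC, hμC⟩ := exists_quotientMeasure_levi_eq_smul_map F hc hA μ hμ κ μN
  exact ⟨C, hC, fun γ hγ f hf =>
    integral_descConj_eq_smul_integral_prod_of_continuous κ μN μ hμC γ hγ f hf⟩

end GeneralLinear

/-! ### 3. Two blocks: `U_c(F)` is commutative, so its Haar measures are inversion invariant -/

section TwoBlocks

open Literature.NumberTheory.GaloisRepresentations.IsNonarchimedeanLocalField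

variable (F : Type*) [Field F] [ValuativeRel F] [TopologicalSpace F] [IsNonarchimedeanLocalField F]

/-- **Box coordinates on the unipotent radical `U_c ≤ GL_n(R)` of a two-block parabolic**: a
homeomorphism `Φ : R^{I × J} ≃ₜ U_c(R)` (`I = {c = false}`, `J = {c = true}`) with `Φ(x) = 1 + X`,
`X` the matrix supported on the box `I × J` with entries `x`, and `Φ(x + y) = Φ(x) Φ(y)` — the tree's
`exists_boxHomeomorph_unipotentRadicalP` (for `U_c` as a subgroup of `P_c`) transported along the
tautological identification `unipotentRadicalGL ≃ unipotentRadicalP`. (Bernstein–Zelevinsky 1977,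
§2.1: `U_β ≅ Hom`; the abelian unipotent radical of a maximal parabolic.) [cite: BernsteinZelevinsky1977, §2.1] -/
theorem exists_boxHomeomorph_unipotentRadicalGL {R : Type*} [CommRing R] [TopologicalSpace R]
    [IsTopologicalRing R] {n : Type*} [Fintype n] [DecidableEq n] (c : n → Bool) :
    ∃ Φ : ({i : n // c i = false} × {j : n // c j = true} → R) ≃ₜ ↥(unipotentRadicalGL R c),
      (∀ x (i j : n), ((Φ x : GL n R) : Matrix n n R) i j =
          (if i = j then 1 else 0) +
            if h : c i = false ∧ c j = true then x (⟨i, h.1⟩, ⟨j, h.2⟩) else 0) ∧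
      (∀ x y, Φ (x + y) = Φ x * Φ y) := by
  obtain ⟨Φ₀, hΦ₀, hadd, -⟩ := exists_boxHomeomorph_unipotentRadicalP R c
  have hmem : ∀ x : ↥(unipotentRadicalGL R c),
      (⟨x.1, unipotentRadicalGL_le R c x.2⟩ : standardParabolicGL R c) ∈ unipotentRadicalP R c :=
    fun x => by rw [← unipotentRadicalGL_subgroupOf, Subgroup.mem_subgroupOf]; exact x.2
  have hmem' : ∀ p : standardParabolicGL R c, p ∈ unipotentRadicalP R c →
      (p : GL n R) ∈ unipotentRadicalGL R c := fun p hp => by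
    rw [← unipotentRadicalGL_subgroupOf, Subgroup.mem_subgroupOf] at hp
    exact hp
  let h₂ : ↥(unipotentRadicalGL R c) ≃ₜ ↥(unipotentRadicalP R c) :=
  { toFun := fun x => ⟨⟨x.1, unipotentRadicalGL_le R c x.2⟩, hmem x⟩
    invFun := fun y => ⟨y.1.1, hmem' y.1 y.2⟩
    left_inv := fun x => rfl
    right_inv := fun y => rfl
    continuous_toFun := (continuous_subtype_val.subtype_mk _).subtype_mk _
    continuous_invFun := (continuous_subtype_val.comp continuous_subtype_val).subtype_mk _ }
  refine ⟨Φ₀.trans h₂.symm, fun x i j => hΦ₀ x i j, fun x y => ?_⟩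
  apply Subtype.ext
  change (((Φ₀ (x + y) : ↥(unipotentRadicalP R c)) : standardParabolicGL R c) : GL n R) =
    ((Φ₀ x : standardParabolicGL R c) : GL n R) * ((Φ₀ y : standardParabolicGL R c) : GL n R)
  rw [hadd, Subgroup.coe_mul, Subgroup.coe_mul]

/-- **For a two-block labelling `c : n → Bool` every Haar measure on the unipotent radical `U_c(F)`
of `GL_n(F)` is inversion invariant**: `U_c ≅ F^{I × J}` (box coordinates `Φ`, additive:
`exists_boxHomeomorph_unipotentRadicalGL`) is commutative, so a left Haar measure is right invariant,
and `isInvInvariant_of_isMulRightInvariant` applies. This discharges the hypothesis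
`[μN.IsInvInvariant]` of `exists_quotientMeasure_levi_eq_smul_map` for maximal parabolics (Rogawski's
`P` of type `(2, 1)` in `GL_3`). [cite: BernsteinZelevinsky1977, §2.1] -/
theorem isInvInvariant_haar_unipotentRadicalGL {n : Type*} [Fintype n] [DecidableEq n] (c : n → Bool)
    [MeasurableSpace ↥(unipotentRadicalGL F c)] [BorelSpace ↥(unipotentRadicalGL F c)]
    (ν : Measure ↥(unipotentRadicalGL F c)) [IsHaarMeasure ν] : ν.IsInvInvariant := by
  classical
  haveI : T2Space F := (isLocalField F).toT2Space
  haveI : SecondCountableTopology F := secondCountableTopology_localField F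
  haveI : LocallyCompactSpace F := (isLocalField F).toLocallyCompactSpace
  obtain ⟨Φ, -, hΦadd⟩ := exists_boxHomeomorph_unipotentRadicalGL (R := F) c
  haveI : SecondCountableTopology ↥(unipotentRadicalGL F c) := Φ.symm.secondCountableTopology
  haveI : LocallyCompactSpace ↥(unipotentRadicalGL F c) :=
    Φ.symm.isClosedEmbedding.locallyCompactSpace
  -- `U_c` is commutative: every element is a `Φ x`, and `Φ x Φ y = Φ (x + y)`
  have hcomm : ∀ u v : ↥(unipotentRadicalGL F c), u * v = v * u := by
    intro u v
    obtain ⟨x, rfl⟩ := Φ.surjective u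
    obtain ⟨y, rfl⟩ := Φ.surjective v
    rw [← hΦadd, ← hΦadd, add_comm]
  haveI : ν.IsMulRightInvariant := ⟨fun g => by
    have hfun : (fun u : ↥(unipotentRadicalGL F c) => u * g) = fun u => g * u :=
      funext fun u => hcomm u g
    rw [hfun, map_mul_left_eq_self]⟩
  exact isInvInvariant_of_isMulRightInvariant ν

variable {n : ℕ} {c : Fin n → Bool} [MeasurableSpace (GL (Fin n) F)] [BorelSpace (GL (Fin n) F)]

/-- **Two blocks** (`GL_n ⊃ P_{(n₁, n₂)}`, e.g. Rogawski's `GL_3 ⊃ P_{(2,1)}`): every non-zero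
invariant measure on `GL_n(F) ⧸ M_c(F)` finite on compact sets is `C • ((k, u) ↦ k u M_c)_* (κ ⊗ μ_U)`,
`C ≠ 0`, for ANY Haar measures `κ` on `GL_n(𝒪)` and `μ_U` on `U_c` (`exists_quotientMeasure_levi_eq_smul_map`
with `isInvInvariant_haar_unipotentRadicalGL`). [cite: Rogawski1990, §4.13, proof of Lemma 4.13.1, p. 70] -/
theorem exists_quotientMeasure_levi_eq_smul_map_bool (hc : Monotone c)
    {A : Subgroup (GL (Fin n) F)} (hA : A = standardLeviGL F c)
    [MeasurableSpace (GL (Fin n) F ⧸ A)] [BorelSpace (GL (Fin n) F ⧸ A)]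
    (μ : Measure (GL (Fin n) F ⧸ A)) [SMulInvariantMeasure (GL (Fin n) F) (GL (Fin n) F ⧸ A) μ]
    [IsFiniteMeasureOnCompacts μ] (hμ : μ ≠ 0)
    (κ : Measure ↥(glInt n F)) [IsHaarMeasure κ]
    (μN : Measure ↥(unipotentRadicalGL F c)) [IsHaarMeasure μN] :
    ∃ C : ℝ≥0, C ≠ 0 ∧ μ = C • Measure.map
      (fun p : ↥(glInt n F) × ↥(unipotentRadicalGL F c) =>
        (QuotientGroup.mk ((p.1 : GL (Fin n) F) * (p.2 : GL (Fin n) F)) : GL (Fin n) F ⧸ A))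
      (κ.prod μN) := by
  haveI : BorelSpace ↥(unipotentRadicalGL F c) := Subtype.borelSpace _
  haveI : μN.IsInvInvariant := isInvInvariant_haar_unipotentRadicalGL F c μN
  exact exists_quotientMeasure_levi_eq_smul_map F hc hA μ hμ κ μN

/-- **Two blocks, integral form**: ONE constant `C ≠ 0` with
`∫_{G ⧸ A} f(y γ y⁻¹) dμ = C ∫_{K × U_c} f((k u) γ (k u)⁻¹) d(κ ⊗ μ_U)` for every continuous `f` and
every `γ` centralised by `A = M_c` — for `c` of type `(2, 1)` and `γ = diag(e₁, e₁, e₂)`, `e₁ ≠ e₂`,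
the left side is Rogawski's orbital integral `Φ(γ, f)` at the `M`-central `(G, M)`-regular point
(`A = C_G(γ) = M`, `centralizer_blockDiagonalGL_scalar_eq_standardLeviGL`). [cite: Rogawski1990, §4.13, proof of Lemma 4.13.1, p. 70] -/
theorem exists_integral_descConj_levi_eq_smul_bool (hc : Monotone c)
    {A : Subgroup (GL (Fin n) F)} (hA : A = standardLeviGL F c)
    [MeasurableSpace (GL (Fin n) F ⧸ A)] [BorelSpace (GL (Fin n) F ⧸ A)]
    (μ : Measure (GL (Fin n) F ⧸ A)) [SMulInvariantMeasure (GL (Fin n) F) (GL (Fin n) F ⧸ A) μ]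
    [IsFiniteMeasureOnCompacts μ] (hμ : μ ≠ 0)
    (κ : Measure ↥(glInt n F)) [IsHaarMeasure κ]
    (μN : Measure ↥(unipotentRadicalGL F c)) [IsHaarMeasure μN]
    {E : Type*} [NormedAddCommGroup E] [NormedSpace ℝ E] :
    ∃ C : ℝ≥0, C ≠ 0 ∧ ∀ (γ : GL (Fin n) F) (hγ : ∀ a ∈ A, a * γ = γ * a) (f : GL (Fin n) F → E),
      Continuous f →
        ∫ y, descConj γ A hγ f y ∂μ =
          C • ∫ p : ↥(glInt n F) × ↥(unipotentRadicalGL F c),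
            f ((p.1 : GL (Fin n) F) * (p.2 : GL (Fin n) F) * γ *
              ((p.1 : GL (Fin n) F) * (p.2 : GL (Fin n) F))⁻¹) ∂(κ.prod μN) := by
  haveI : BorelSpace ↥(unipotentRadicalGL F c) := Subtype.borelSpace _
  haveI : μN.IsInvInvariant := isInvInvariant_haar_unipotentRadicalGL F c μN
  exact exists_integral_descConj_levi_eq_smul F hc hA μ hμ κ μN

end TwoBlocks

end Literature.NumberTheory.Automorphic
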